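import Mathlib
import Summits.KontsevichZagierPeriods.KontsevichZagierPeriods.Theorems.SoloInformedLogRoomFibre
import HarnessLib

/-!
# SoloInformed — the log-moment inequality on a prepared fibre

Solo programme `solo-KontsevichZagierPeriods-informed`, attempt (A390-ii), file F2c of the
KERNEL LEMMA I programme (integrability loci of `ℚ`-semialgebraic families are
`ℚ`-semialgebraic, via the vendored Lion–Rolin preparation fact
`Literature.ModelTheory.ExponentialFields.semialgebraicPreparation`).

On a band of a Lion–Rolin prepared cell the function reads, along each vertical fibre
`J = (l, u)` (endpoints in `EReal`, centre `θ ∉ J`), `g y = A |y - θ|^r V y` with a unit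
`c⁻¹ ≤ V ≤ c`; the other prepared functions of the family contribute centres `θ'ᵢ ∉ J`.
The main result `soloInformed_preparedFibre_logMoment` is the FIBRE STEP of the log-room
theorem T'(m):

  `∫_J |g| (K + Σᵢ R'ᵢ |log|y - θ'ᵢ||)^p ≤ C c² R^p (1 + K + Σᵢ log⁺|θ'ᵢ - θ| + F(l,u,θ))^p ∫_J |g|`

with `C = C(r,p,N)` and the fibre data `F(l,u,θ) = soloInformedFibreData l u θ`, a sum of
`log⁺` of differences of the (real parts of the) endpoints and the centre — so that, once the
endpoints and centres are semialgebraic functions of the base point, the right-hand constant is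
dominated by `(1 + K + Σⱼ |log σⱼ|)^p` for finitely many semialgebraic `σⱼ`
(`soloInformed_fibreData_le`).  Ingredients: the normalisation `y = θ ± s` of file F2a
(`SoloInformedFibreInterval`) and the several-centres log-room of file F2b
(`SoloInformedLogRoomFibre`).

References: Lion–Rolin, Ann. Inst. Fourier 48 (1998) 755–767, §1 (`LionRolin1998`);
Comte–Lion–Rolin, Illinois J. Math. 44 (2000) 884–888, Thm 1′ (`doi:10.1215/ijm/1255984698`).
-/

noncomputable section

open MeasureTheory Set Real
open scoped ENNReal

namespace Summit.KontsevichZagierPeriods.KontsevichZagierPeriods.Theorems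

/-! ### Normalisation data of a fibre relative to a centre -/

/-- Fibre above the centre (`θ ≤ l < u`): the normalised fibre `(l - θ, u - θ)` has
`0 ≤ l - θ < u - θ` and upper endpoint `⊤` or the real `u.toReal - θ`. [cite: LionRolin1998, §1] -/
theorem soloInformed_normalised_above {l u : EReal} {θ : ℝ} (hθl : (θ : EReal) ≤ l) (hlu : l < u) :
    0 ≤ l.toReal - θ ∧ ((l.toReal - θ : ℝ) : EReal) < u - θ ∧
      (u - θ = ⊤ ∨ u - θ = ((u.toReal - θ : ℝ) : EReal)) := by
  obtain ⟨l₀, rfl⟩ : ∃ l₀ : ℝ, l = (l₀ : EReal) := ⟨l.toReal, soloInformed_EIoo_lower_eq_coe hθl hlu⟩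
  have hθl₀ : θ ≤ l₀ := by exact_mod_cast hθl
  rw [EReal.toReal_coe]
  refine ⟨by linarith, ?_, ?_⟩
  · induction u using EReal.rec with
    | bot => exact absurd hlu (by simp)
    | coe u₀ =>
      rw [← EReal.coe_sub, EReal.coe_lt_coe_iff]
      have : l₀ < u₀ := by exact_mod_cast hlu
      linarith
    | top => rw [EReal.top_sub_coe]; exact EReal.coe_lt_top _
  · induction u using EReal.rec with
    | bot => exact absurd hlu (by simp)
    | coe u₀ => right; rw [← EReal.coe_sub, EReal.toReal_coe]
    | top => left; rw [EReal.top_sub_coe]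

/-- Fibre below the centre (`l < u ≤ θ`): the normalised fibre `(θ - u, θ - l)` has
`0 ≤ θ - u < θ - l` and upper endpoint `⊤` or the real `θ - l.toReal`. [cite: LionRolin1998, §1] -/
theorem soloInformed_normalised_below {l u : EReal} {θ : ℝ} (huθ : u ≤ (θ : EReal)) (hlu : l < u) :
    0 ≤ θ - u.toReal ∧ ((θ - u.toReal : ℝ) : EReal) < (θ : EReal) - l ∧
      ((θ : EReal) - l = ⊤ ∨ (θ : EReal) - l = ((θ - l.toReal : ℝ) : EReal)) := by
  obtain ⟨u₀, rfl⟩ : ∃ u₀ : ℝ, u = (u₀ : EReal) := ⟨u.toReal, soloInformed_EIoo_upper_eq_coe huθ hlu⟩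
  have hu₀θ : u₀ ≤ θ := by exact_mod_cast huθ
  rw [EReal.toReal_coe]
  refine ⟨by linarith, ?_, ?_⟩
  · induction l using EReal.rec with
    | bot => rw [EReal.coe_sub_bot]; exact EReal.coe_lt_top _
    | coe l₀ =>
      rw [← EReal.coe_sub, EReal.coe_lt_coe_iff]
      have : l₀ < u₀ := by exact_mod_cast hlu
      linarith
    | top => exact absurd hlu (by simp)
  · induction l using EReal.rec with
    | bot => left; rw [EReal.coe_sub_bot]
    | coe l₀ => right; rw [← EReal.coe_sub, EReal.toReal_coe]
    | top => exact absurd hlu (by simp)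

/-- Fibre data `F(l,u,θ)`: the endpoint data of both candidate normalisations (above / below the
centre); the one not in force is a harmless nonnegative junk term. [cite: LionRolin1998, §1] -/
def soloInformedFibreData (l u : EReal) (θ : ℝ) : ℝ :=
  soloInformedEndData (l.toReal - θ) (u.toReal - θ) + soloInformedEndData (θ - u.toReal) (θ - l.toReal)

/-- Fibre data is nonnegative. [cite: LionRolin1998, §1] -/
theorem soloInformed_fibreData_nonneg (l u : EReal) (θ : ℝ) : 0 ≤ soloInformedFibreData l u θ :=
  add_nonneg (soloInformed_endData_nonneg _ _) (soloInformed_endData_nonneg _ _)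

/-- `log⁺ x ≤ |log x|`. [cite: LionRolin1998, §1] -/
theorem soloInformed_posLog_le_abs_log (x : ℝ) : log⁺ x ≤ |Real.log x| := by
  rw [Real.posLog_apply]
  exact max_le (abs_nonneg _) (le_abs_self _)

/-- `log⁺ x⁻¹ ≤ |log x|`. [cite: LionRolin1998, §1] -/
theorem soloInformed_posLog_inv_le_abs_log (x : ℝ) : log⁺ x⁻¹ ≤ |Real.log x| := by
  rw [Real.posLog_apply, Real.log_inv]
  exact max_le (abs_nonneg _) (neg_le_abs _)

/-- Endpoint data is dominated by logarithms: `E(α₀,b) ≤ 2|log α₀| + 2|log b| + |log (b - α₀)|`.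
[cite: LionRolin1998, §1] -/
theorem soloInformed_endData_le (α₀ b : ℝ) :
    soloInformedEndData α₀ b ≤ 2 * |Real.log α₀| + 2 * |Real.log b| + |Real.log (b - α₀)| := by
  unfold soloInformedEndData
  have h1 := soloInformed_posLog_le_abs_log α₀
  have h2 := soloInformed_posLog_inv_le_abs_log α₀
  have h3 := soloInformed_posLog_le_abs_log b
  have h4 := soloInformed_posLog_inv_le_abs_log b
  have h5 := soloInformed_posLog_inv_le_abs_log (b - α₀)
  linarith

/-- Fibre data is dominated by logarithms of three differences of endpoints and centre:
`F(l,u,θ) ≤ 4|log(l.toReal - θ)| + 4|log(u.toReal - θ)| + 2|log(u.toReal - l.toReal)|`.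
[cite: LionRolin1998, §1] -/
theorem soloInformed_fibreData_le (l u : EReal) (θ : ℝ) :
    soloInformedFibreData l u θ ≤ 4 * |Real.log (l.toReal - θ)| + 4 * |Real.log (u.toReal - θ)| +
      2 * |Real.log (u.toReal - l.toReal)| := by
  unfold soloInformedFibreData
  have h1 := soloInformed_endData_le (l.toReal - θ) (u.toReal - θ)
  have h2 := soloInformed_endData_le (θ - u.toReal) (θ - l.toReal)
  have e1 : Real.log (θ - u.toReal) = Real.log (u.toReal - θ) := by
    rw [← Real.log_neg_eq_log, neg_sub]
  have e2 : Real.log (θ - l.toReal) = Real.log (l.toReal - θ) := by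
    rw [← Real.log_neg_eq_log, neg_sub]
  have e3 : u.toReal - θ - (l.toReal - θ) = u.toReal - l.toReal := by ring
  have e4 : θ - l.toReal - (θ - u.toReal) = u.toReal - l.toReal := by ring
  rw [e3] at h1
  rw [e1, e2, e4] at h2
  linarith

/-! ### Prepared terms on a fibre: pointwise and integral comparison -/

/-- A prepared value `g = A u^r V` with unit `c⁻¹ ≤ V ≤ c` satisfies
`c⁻¹ |A| u^r ≤ |g| ≤ c |A| u^r` (`u ≥ 0`). [cite: LionRolin1998, §1] -/
theorem soloInformed_prepared_abs_bounds {A u r c V g : ℝ} (hc : 1 ≤ c) (hV : c⁻¹ ≤ V ∧ V ≤ c)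
    (hg : g = A * u ^ r * V) (hu : 0 ≤ u) :
    c⁻¹ * |A| * u ^ r ≤ |g| ∧ |g| ≤ c * |A| * u ^ r := by
  have hc0 : 0 < c := by linarith
  have hV0 : 0 < V := lt_of_lt_of_le (inv_pos.mpr hc0) hV.1
  have hur : 0 ≤ u ^ r := Real.rpow_nonneg hu r
  have habs : |g| = |A| * u ^ r * V := by
    rw [hg, abs_mul, abs_mul, abs_of_nonneg hur, abs_of_pos hV0]
  rw [habs]
  have hAu : 0 ≤ |A| * u ^ r := mul_nonneg (abs_nonneg A) hur
  constructor
  · calc c⁻¹ * |A| * u ^ r = |A| * u ^ r * c⁻¹ := by ring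
      _ ≤ |A| * u ^ r * V := mul_le_mul_of_nonneg_left hV.1 hAu
  · calc |A| * u ^ r * V ≤ |A| * u ^ r * c := mul_le_mul_of_nonneg_left hV.2 hAu
      _ = c * |A| * u ^ r := by ring

/-- Weighted upper bound: `∫_J |g| Φ ≤ c|A| ∫_J |y-θ|^r Φ` for a prepared `g` and `Φ ≥ 0`.
[cite: LionRolin1998, §1] -/
theorem soloInformed_prepared_lintegral_upper {J : Set ℝ} (hJ : MeasurableSet J) {g V Φ : ℝ → ℝ}
    {A θ r c : ℝ} (hc : 1 ≤ c) (hg : ∀ y ∈ J, g y = A * |y - θ| ^ r * V y)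
    (hV : ∀ y ∈ J, c⁻¹ ≤ V y ∧ V y ≤ c) (hΦ : ∀ y ∈ J, 0 ≤ Φ y) :
    ∫⁻ y in J, ENNReal.ofReal (|g y| * Φ y) ≤
      ENNReal.ofReal (c * |A|) * ∫⁻ y in J, ENNReal.ofReal (|y - θ| ^ r * Φ y) := by
  calc ∫⁻ y in J, ENNReal.ofReal (|g y| * Φ y)
      ≤ ∫⁻ y in J, ENNReal.ofReal (c * |A| * (|y - θ| ^ r * Φ y)) := by
        refine setLIntegral_mono' hJ (fun y hy => ENNReal.ofReal_le_ofReal ?_)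
        have h := (soloInformed_prepared_abs_bounds hc (hV y hy) (hg y hy) (abs_nonneg (y - θ))).2
        calc |g y| * Φ y ≤ (c * |A| * |y - θ| ^ r) * Φ y := mul_le_mul_of_nonneg_right h (hΦ y hy)
          _ = c * |A| * (|y - θ| ^ r * Φ y) := by ring
    _ = ENNReal.ofReal (c * |A|) * ∫⁻ y in J, ENNReal.ofReal (|y - θ| ^ r * Φ y) :=
        soloInformed_setLIntegral_ofReal_const_mul
          (mul_nonneg (le_trans zero_le_one hc) (abs_nonneg A)) _ _

/-- Lower bound: `c⁻¹|A| ∫_J |y-θ|^r ≤ ∫_J |g|` for a prepared `g`. [cite: LionRolin1998, §1] -/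
theorem soloInformed_prepared_lintegral_lower {J : Set ℝ} (hJ : MeasurableSet J) {g V : ℝ → ℝ}
    {A θ r c : ℝ} (hc : 1 ≤ c) (hg : ∀ y ∈ J, g y = A * |y - θ| ^ r * V y)
    (hV : ∀ y ∈ J, c⁻¹ ≤ V y ∧ V y ≤ c) :
    ENNReal.ofReal (c⁻¹ * |A|) * ∫⁻ y in J, ENNReal.ofReal (|y - θ| ^ r) ≤
      ∫⁻ y in J, ENNReal.ofReal |g y| := by
  have hc0 : 0 < c := by linarith
  calc ENNReal.ofReal (c⁻¹ * |A|) * ∫⁻ y in J, ENNReal.ofReal (|y - θ| ^ r)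
      = ∫⁻ y in J, ENNReal.ofReal (c⁻¹ * |A| * |y - θ| ^ r) :=
        (soloInformed_setLIntegral_ofReal_const_mul
          (mul_nonneg (le_of_lt (inv_pos.mpr hc0)) (abs_nonneg A)) _ _).symm
    _ ≤ ∫⁻ y in J, ENNReal.ofReal |g y| :=
        setLIntegral_mono' hJ (fun y hy => ENNReal.ofReal_le_ofReal
          (soloInformed_prepared_abs_bounds hc (hV y hy) (hg y hy) (abs_nonneg (y - θ))).1)

/-- Mass comparison: `|A| ∫_J |y-θ|^r ≤ c ∫_J |g|` for a prepared `g`. [cite: LionRolin1998, §1] -/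
theorem soloInformed_prepared_mass_le {J : Set ℝ} (hJ : MeasurableSet J) {g V : ℝ → ℝ}
    {A θ r c : ℝ} (hc : 1 ≤ c) (hg : ∀ y ∈ J, g y = A * |y - θ| ^ r * V y)
    (hV : ∀ y ∈ J, c⁻¹ ≤ V y ∧ V y ≤ c) :
    ENNReal.ofReal |A| * ∫⁻ y in J, ENNReal.ofReal (|y - θ| ^ r) ≤
      ENNReal.ofReal c * ∫⁻ y in J, ENNReal.ofReal |g y| := by
  have hc0 : 0 < c := by linarith
  have h := soloInformed_prepared_lintegral_lower hJ hc hg hV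
  have hA : |A| = c * (c⁻¹ * |A|) := by
    rw [← mul_assoc, mul_inv_cancel₀ hc0.ne', one_mul]
  calc ENNReal.ofReal |A| * ∫⁻ y in J, ENNReal.ofReal (|y - θ| ^ r)
      = ENNReal.ofReal c * (ENNReal.ofReal (c⁻¹ * |A|) * ∫⁻ y in J, ENNReal.ofReal (|y - θ| ^ r)) := by
        rw [← mul_assoc, ← ENNReal.ofReal_mul (le_of_lt hc0), ← hA]
    _ ≤ ENNReal.ofReal c * ∫⁻ y in J, ENNReal.ofReal |g y| := mul_le_mul_of_nonneg_left h zero_le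

/-! ### The fibre step of the log-room theorem -/

/-- PREPARED-FIBRE LOG-MOMENT INEQUALITY.  For every exponent `r`, power `p` and number `N` of
extra centres there is `C ≥ 1` such that on every fibre `J = (l, u)` (`l < u` in `EReal`) with
centre `θ ∉ J`, extra centres `θ'ᵢ ∉ J`, weights `0 ≤ R'ᵢ ≤ R` (`R ≥ 1`), `K ≥ 0`, and every
prepared `g = A |y-θ|^r V`, `c⁻¹ ≤ V ≤ c`:
`∫_J |g| (K + Σᵢ R'ᵢ |log|y-θ'ᵢ||)^p ≤ C c² R^p (1 + K + Σᵢ log⁺|θ'ᵢ-θ| + F(l,u,θ))^p ∫_J |g|`.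
[cite: LionRolin1998, §1] -/
theorem soloInformed_preparedFibre_logMoment (r : ℝ) (p N : ℕ) : ∃ C : ℝ, 1 ≤ C ∧
    ∀ (l u : EReal) (θ A c K R : ℝ) (θ' R' : Fin N → ℝ) (g V : ℝ → ℝ),
      l < u → θ ∉ soloInformedEIoo l u → (∀ i, θ' i ∉ soloInformedEIoo l u) → 1 ≤ c → 0 ≤ K →
      1 ≤ R → (∀ i, 0 ≤ R' i ∧ R' i ≤ R) →
      (∀ y ∈ soloInformedEIoo l u, g y = A * |y - θ| ^ r * V y) →
      (∀ y ∈ soloInformedEIoo l u, c⁻¹ ≤ V y ∧ V y ≤ c) →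
      ∫⁻ y in soloInformedEIoo l u,
          ENNReal.ofReal (|g y| * (K + ∑ i, R' i * |Real.log (|y - θ' i|)|) ^ p) ≤
        ENNReal.ofReal (C * c ^ 2 * R ^ p *
            (1 + K + ∑ i, log⁺ |θ' i - θ| + soloInformedFibreData l u θ) ^ p) *
          ∫⁻ y in soloInformedEIoo l u, ENNReal.ofReal |g y| := by
  obtain ⟨C₁, hC₁, H⟩ := soloInformed_logRoom_EIoo_sum r p N
  refine ⟨C₁, hC₁, ?_⟩
  intro l u θ A c K R θ' R' g V hlu hθ hθ' hc hK hR hR' hg hV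
  set J := soloInformedEIoo l u with hJ
  have hJm : MeasurableSet J := soloInformed_measurableSet_EIoo l u
  set Φ : ℝ → ℝ := fun y => (K + ∑ i, R' i * |Real.log (|y - θ' i|)|) ^ p with hΦ
  have hΦ0 : ∀ y ∈ J, 0 ≤ Φ y := fun y _ =>
    pow_nonneg (add_nonneg hK (Finset.sum_nonneg fun i _ => mul_nonneg (hR' i).1 (abs_nonneg _))) p
  set F := soloInformedFibreData l u θ with hF
  set M := 1 + K + ∑ i, log⁺ |θ' i - θ| + F with hM
  have hF0 : 0 ≤ F := soloInformed_fibreData_nonneg l u θ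
  have hlog0 : ∀ i, (0 : ℝ) ≤ log⁺ |θ' i - θ| := fun i => Real.posLog_nonneg
  have hsum0 : 0 ≤ ∑ i, log⁺ |θ' i - θ| := Finset.sum_nonneg fun i _ => hlog0 i
  have hC10 : 0 ≤ C₁ := le_trans zero_le_one hC₁
  have hR0 : 0 ≤ R := le_trans zero_le_one hR
  have hc0 : 0 < c := by linarith
  have hCR : 0 ≤ C₁ * R ^ p := mul_nonneg hC10 (pow_nonneg hR0 p)
  set Iθ := ∫⁻ y in J, ENNReal.ofReal (|y - θ| ^ r) with hIθ
  -- the weighted integral in the normal variable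
  have hkey : ∫⁻ y in J, ENNReal.ofReal (|y - θ| ^ r * Φ y) ≤
      ENNReal.ofReal (C₁ * R ^ p * M ^ p) * Iθ := by
    rcases soloInformed_EIoo_side hθ with hθl | huθ
    · -- the fibre lies above the centre: y = θ + s
      obtain ⟨hα, hαβ, hβ⟩ := soloInformed_normalised_above hθl hlu
      have hd : ∀ i, (((fun i => θ' i - θ) i : ℝ) : EReal) ≤ ((l.toReal - θ : ℝ) : EReal) ∨
          u - θ ≤ (((fun i => θ' i - θ) i : ℝ) : EReal) :=
        fun i => soloInformed_excluded_above hθl hlu (hθ' i)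
      have h1 := H (l.toReal - θ) (u - θ) (u.toReal - θ) K R (fun i => θ' i - θ) R' hα hαβ hβ hd hK hR hR'
      have e1 : ∫⁻ y in J, ENNReal.ofReal (|y - θ| ^ r * Φ y) =
          ∫⁻ s in soloInformedEIoo ((l.toReal - θ : ℝ) : EReal) (u - θ),
            ENNReal.ofReal (s ^ r * (K + ∑ i, R' i * |Real.log (|s - (θ' i - θ)|)|) ^ p) :=
        soloInformed_fibre_subst_above hθl hlu θ'
          (fun s v => ENNReal.ofReal (s ^ r * (K + ∑ i, R' i * |Real.log (v i)|) ^ p))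
      have e2 : Iθ = ∫⁻ s in soloInformedEIoo ((l.toReal - θ : ℝ) : EReal) (u - θ),
          ENNReal.ofReal (s ^ r) :=
        soloInformed_fibre_subst_above hθl hlu θ' (fun s _ => ENNReal.ofReal (s ^ r))
      have hE : soloInformedEndData (l.toReal - θ) (u.toReal - θ) ≤ F := by
        rw [hF]; unfold soloInformedFibreData
        linarith [soloInformed_endData_nonneg (θ - u.toReal) (θ - l.toReal)]
      have hM1 : 0 ≤ 1 + K + ∑ i, log⁺ |θ' i - θ| + soloInformedEndData (l.toReal - θ) (u.toReal - θ) := by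
        linarith [soloInformed_endData_nonneg (l.toReal - θ) (u.toReal - θ)]
      have hM2 : 1 + K + ∑ i, log⁺ |θ' i - θ| + soloInformedEndData (l.toReal - θ) (u.toReal - θ) ≤ M := by
        rw [hM]; linarith
      have hMle : C₁ * R ^ p *
          (1 + K + ∑ i, log⁺ |θ' i - θ| + soloInformedEndData (l.toReal - θ) (u.toReal - θ)) ^ p ≤
          C₁ * R ^ p * M ^ p :=
        mul_le_mul_of_nonneg_left (pow_le_pow_left₀ hM1 hM2 p) hCR
      rw [e1, e2]
      exact h1.trans (mul_le_mul_of_nonneg_right (ENNReal.ofReal_le_ofReal hMle) zero_le)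
    · -- the fibre lies below the centre: y = θ - s
      obtain ⟨hα, hαβ, hβ⟩ := soloInformed_normalised_below huθ hlu
      have hd : ∀ i, (((fun i => θ - θ' i) i : ℝ) : EReal) ≤ ((θ - u.toReal : ℝ) : EReal) ∨
          (θ : EReal) - l ≤ (((fun i => θ - θ' i) i : ℝ) : EReal) :=
        fun i => soloInformed_excluded_below huθ hlu (hθ' i)
      have h1 := H (θ - u.toReal) ((θ : EReal) - l) (θ - l.toReal) K R (fun i => θ - θ' i) R'
        hα hαβ hβ hd hK hR hR'
      have e1 : ∫⁻ y in J, ENNReal.ofReal (|y - θ| ^ r * Φ y) =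
          ∫⁻ s in soloInformedEIoo ((θ - u.toReal : ℝ) : EReal) ((θ : EReal) - l),
            ENNReal.ofReal (s ^ r * (K + ∑ i, R' i * |Real.log (|s - (θ - θ' i)|)|) ^ p) :=
        soloInformed_fibre_subst_below huθ hlu θ'
          (fun s v => ENNReal.ofReal (s ^ r * (K + ∑ i, R' i * |Real.log (v i)|) ^ p))
      have e2 : Iθ = ∫⁻ s in soloInformedEIoo ((θ - u.toReal : ℝ) : EReal) ((θ : EReal) - l),
          ENNReal.ofReal (s ^ r) :=
        soloInformed_fibre_subst_below huθ hlu θ' (fun s _ => ENNReal.ofReal (s ^ r))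
      have hE : soloInformedEndData (θ - u.toReal) (θ - l.toReal) ≤ F := by
        rw [hF]; unfold soloInformedFibreData
        linarith [soloInformed_endData_nonneg (l.toReal - θ) (u.toReal - θ)]
      have hsym : ∑ i, log⁺ |θ - θ' i| = ∑ i, log⁺ |θ' i - θ| :=
        Finset.sum_congr rfl fun i _ => by rw [abs_sub_comm]
      have hM1 : 0 ≤ 1 + K + ∑ i, log⁺ |θ - θ' i| + soloInformedEndData (θ - u.toReal) (θ - l.toReal) := by
        rw [hsym]; linarith [soloInformed_endData_nonneg (θ - u.toReal) (θ - l.toReal)]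
      have hM2 : 1 + K + ∑ i, log⁺ |θ - θ' i| + soloInformedEndData (θ - u.toReal) (θ - l.toReal) ≤ M := by
        rw [hsym, hM]; linarith
      have hMle : C₁ * R ^ p *
          (1 + K + ∑ i, log⁺ |θ - θ' i| + soloInformedEndData (θ - u.toReal) (θ - l.toReal)) ^ p ≤
          C₁ * R ^ p * M ^ p :=
        mul_le_mul_of_nonneg_left (pow_le_pow_left₀ hM1 hM2 p) hCR
      rw [e1, e2]
      exact h1.trans (mul_le_mul_of_nonneg_right (ENNReal.ofReal_le_ofReal hMle) zero_le)
  -- assemble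
  have hM0 : 0 ≤ M := by rw [hM]; linarith
  have hX0 : 0 ≤ C₁ * R ^ p * M ^ p := mul_nonneg hCR (pow_nonneg hM0 p)
  calc ∫⁻ y in J, ENNReal.ofReal (|g y| * Φ y)
      ≤ ENNReal.ofReal (c * |A|) * ∫⁻ y in J, ENNReal.ofReal (|y - θ| ^ r * Φ y) :=
        soloInformed_prepared_lintegral_upper hJm hc hg hV hΦ0
    _ ≤ ENNReal.ofReal (c * |A|) * (ENNReal.ofReal (C₁ * R ^ p * M ^ p) * Iθ) :=
        mul_le_mul_of_nonneg_left hkey zero_le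
    _ = ENNReal.ofReal (c * (C₁ * R ^ p * M ^ p)) * (ENNReal.ofReal |A| * Iθ) := by
        rw [ENNReal.ofReal_mul (le_of_lt hc0), ENNReal.ofReal_mul (le_of_lt hc0)]; ring
    _ ≤ ENNReal.ofReal (c * (C₁ * R ^ p * M ^ p)) *
          (ENNReal.ofReal c * ∫⁻ y in J, ENNReal.ofReal |g y|) :=
        mul_le_mul_of_nonneg_left (soloInformed_prepared_mass_le hJm hc hg hV) zero_le
    _ = ENNReal.ofReal (C₁ * c ^ 2 * R ^ p * M ^ p) * ∫⁻ y in J, ENNReal.ofReal |g y| := by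
        rw [← mul_assoc, ← ENNReal.ofReal_mul (mul_nonneg (le_of_lt hc0) hX0)]
        congr 2
        ring

end Summit.KontsevichZagierPeriods.KontsevichZagierPeriods.Theorems

end
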